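import Literature.AlgebraicGeometry.Crystalline.KaehlerExteriorDerivativeAux
import HarnessLib

/-!
# The exterior derivative on the algebra of Kähler differential forms `⋀_B Ω[B⁄A]`

For a commutative ring `A` and a commutative `A`-algebra `B`, let `Ω[B⁄A]` be the module of Kähler
differentials (Mathlib's `KaehlerDifferential`, universal derivation `KaehlerDifferential.D A B`)
and let `E = ExteriorAlgebra B Ω[B⁄A] = ⨁ₙ ⋀ⁿ_B Ω[B⁄A]` be the algebra of (algebraic) differential
forms of `B/A`. This file constructs the **exterior derivative** (de Rham differential)

* `KaehlerExteriorDerivative.extD A B : E →ₗ[A] E`,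

the unique `A`-linear map with `d b = D b` on functions (`extD_algebraMap`), `d (D b) = 0` on exact
one-forms (`extD_ι_D`), and the graded Leibniz rule `d (x * y) = d x * y + x̄ * d y`
(`extD_mul`; `x̄ = CliffordAlgebra.involute x` is the grading involution, `= (-1)ᵖ x` on `p`-forms),
and proves `d ∘ d = 0` (`extD_extD`) and `d x̄ = -(d x)‾` (`extD_involute`). In particular
`d (b • D c) = D b ∧ D c` (`extD_ι_smul_D`), i.e. `d (b dc₁ ∧ ⋯ ∧ dcₙ) = db ∧ dc₁ ∧ ⋯ ∧ dcₙ`.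
The restriction to the graded pieces `d : ⋀ⁿ Ω[B⁄A] → ⋀ⁿ⁺¹ Ω[B⁄A]` (the algebraic de Rham complex of
`B/A`) and its naturality in `B` are in the sequel `Crystalline/KaehlerDeRhamComplex`.

Sources: N. Bourbaki, *Algèbre*, Ch. X (Algèbre homologique) §2 no. 10 / A. Grothendieck, EGA IV₄
(Publ. IHÉS 32, 1967) §16.6 (the exterior differential on `⋀ Ω¹_{X/S}`); The Stacks project,
Tag 0FKF ("de Rham complex" of a ring map: "there exists a unique `A`-linear `d : Ωᵖ → Ωᵖ⁺¹` with
`d(f₀ df₁ ∧ … ∧ dfₚ) = df₀ ∧ df₁ ∧ … ∧ dfₚ`"); R. Hartshorne, *Algebraic Geometry* (1977), III.7,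
p. 225. [folklore]

Construction (design choice): the "odd dual numbers" device of
`Crystalline/KaehlerExteriorDerivativeAux` — the algebra map `theta : E →ₐ[B] End_B (Aux A B)` into
the endomorphisms of the twisted module `Aux A B = E × E`; one proves `theta x = op x (d x)` where
`d x := (theta x (1, 0)).2` (`theta_apply`), and the multiplicativity of `theta` is exactly the graded
Leibniz rule. Everything is proved; no named facts.

Mathlib (pin v4.32.0) has `KaehlerDifferential.D` (degree `0 → 1`), `ExteriorAlgebra`/`exteriorPower`
and `CliffordAlgebra.involute`, but no de Rham differential on higher Kähler forms (searched:
`deRham`, `exteriorDerivative`, `Kaehler` × `ExteriorAlgebra`/`exteriorPower`); the tree's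
`Motives/AffineAlgebraicDeRham` is a concrete polynomial model on closed subschemes of `𝔸ⁿ`, not the
Kähler model, and `Motives/HodgeSheaves` (`Ωᵃ = ⋀ᵃ Ω¹` as sheaves) lists the de Rham differential as
"not here". This file is the ring-level root of the requested `PadicDeRhamComplex`
(`Ω•_{𝒳/W}` as a complex of sheaves) of definition item `defn-PadicDeRhamComplex`.

NOT here: the degree-wise maps `⋀ⁿ → ⋀ⁿ⁺¹` and the `CochainComplex`, naturality, the comparison with
`Motives/AffineAlgebraicDeRham`, sheafification.
-/

noncomputable section

namespace Literature.AlgebraicGeometry.Crystalline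

open KaehlerDifferential (D)
open ExteriorAlgebra (ι)

universe u v

variable (A : Type u) (B : Type v) [CommRing A] [CommRing B] [Algebra A B]

namespace KaehlerExteriorDerivative

/-! ### The exterior derivative on the exterior algebra -/

open Aux

/-- The **exterior derivative** `d : ⋀_B Ω[B⁄A] → ⋀_B Ω[B⁄A]` as a bare function: the
`θ`-coefficient of `Θ x (1, 0)`. See `extD` for the `A`-linear map and `theta_apply`, `extD_mul`,
`extD_algebraMap`, `extD_ι_D`, `extD_extD` for its characterising properties. [folklore] -/
def extDFun (x : ExteriorAlgebra B (Ω[B⁄A])) : ExteriorAlgebra B (Ω[B⁄A]) :=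
  (theta A B x base).snd

/-- The key computation: `Θ x = op x (d x)`, i.e. `Θ x (u, v) = (x u, x̄ v + d x · u)`.
[folklore] -/
theorem theta_apply (x : ExteriorAlgebra B (Ω[B⁄A])) (n : Aux A B) :
    theta A B x n = op x (extDFun A B x) n := by
  induction x using ExteriorAlgebra.induction generalizing n with
  | algebraMap b =>
    have hb : extDFun A B (algebraMap B _ b) = ι B (D A B b) := by
      simp [extDFun, Module.algebraMap_end_apply]
    rw [hb, AlgHom.commutes, Module.algebraMap_end_apply, smul_eq_op_apply]
  | ι ω =>
    obtain ⟨w, -, h⟩ := exists_phi_eq_op A B ω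
    have hw : extDFun A B (ι B ω) = w := by simp [extDFun, h]
    rw [theta_ι, h, hw]
  | mul x y hx hy =>
    have hxy :
        extDFun A B (x * y) = CliffordAlgebra.involute x * extDFun A B y + extDFun A B x * y := by
      change (theta A B (x * y) base).snd = _
      rw [map_mul, Module.End.mul_apply, hy, hx, op_apply_snd, op_apply_snd, op_apply_fst]
      simp only [fst_base, snd_base, mul_zero, zero_add, mul_one]
    rw [map_mul, Module.End.mul_apply, hy, hx, hxy, ← LinearMap.comp_apply, op_comp]
  | add x y hx hy =>
    have hxy : extDFun A B (x + y) = extDFun A B x + extDFun A B y := by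
      simp only [extDFun, map_add, LinearMap.add_apply, snd_add]
    rw [map_add, LinearMap.add_apply, hx, hy, hxy, op_add, LinearMap.add_apply]

/-- **Graded Leibniz rule**: `d (x y) = d x · y + x̄ · d y`. [folklore] -/
theorem extDFun_mul (x y : ExteriorAlgebra B (Ω[B⁄A])) :
    extDFun A B (x * y) = extDFun A B x * y + CliffordAlgebra.involute x * extDFun A B y := by
  conv_lhs => rw [extDFun, map_mul, Module.End.mul_apply, theta_apply, theta_apply]
  simp only [op_apply_snd, op_apply_fst, fst_base, snd_base, mul_zero, zero_add, mul_one]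
  exact add_comm _ _

/-- Additivity of `d`. [folklore] -/
theorem extDFun_add (x y : ExteriorAlgebra B (Ω[B⁄A])) :
    extDFun A B (x + y) = extDFun A B x + extDFun A B y := by
  simp only [extDFun, map_add, LinearMap.add_apply, snd_add]

/-- `d b = D b` on functions (degree `0`). [folklore] -/
@[simp] theorem extDFun_algebraMap (b : B) :
    extDFun A B (algebraMap B _ b) = ι B (D A B b) := by
  simp [extDFun, Module.algebraMap_end_apply]

/-- `d (D b) = 0` on exact one-forms. [folklore] -/
@[simp] theorem extDFun_ι_D (b : B) : extDFun A B (ι B (D A B b)) = 0 := by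
  simp [extDFun]

/-- `A`-linearity: `d (a • x) = a • d x` (as `D a = 0`). [folklore] -/
theorem extDFun_smul (a : A) (x : ExteriorAlgebra B (Ω[B⁄A])) :
    extDFun A B (a • x) = a • extDFun A B x := by
  rw [← IsScalarTower.algebraMap_smul B a x, Algebra.smul_def, extDFun_mul, extDFun_algebraMap,
    Derivation.map_algebraMap, map_zero, zero_mul, zero_add, AlgHom.commutes, ← Algebra.smul_def,
    IsScalarTower.algebraMap_smul]

/-- The **exterior derivative** (de Rham differential) on the algebra of Kähler differential forms
`E = ⋀_B Ω[B⁄A]`, as an `A`-linear map `d : E →ₗ[A] E`: `d b = D b`, `d (D b) = 0`,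
`d (x y) = d x · y + x̄ · d y`, `d (d x) = 0`.
(Bourbaki, *Algèbre* X §2 no. 10; EGA IV₄ 16.6; Stacks 0FKF.) [folklore] -/
def extD : ExteriorAlgebra B (Ω[B⁄A]) →ₗ[A] ExteriorAlgebra B (Ω[B⁄A]) where
  toFun := extDFun A B
  map_add' := extDFun_add A B
  map_smul' := extDFun_smul A B

/-- `extD` is `extDFun` as a function. [folklore] -/
@[simp] theorem extD_apply (x : ExteriorAlgebra B (Ω[B⁄A])) : extD A B x = extDFun A B x := rfl

/-- **Graded Leibniz rule** for the exterior derivative: `d (x y) = d x · y + x̄ · d y`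
(`x̄ = involute x = (-1)ᵖ x` for a `p`-form `x`). [folklore] -/
theorem extD_mul (x y : ExteriorAlgebra B (Ω[B⁄A])) :
    extD A B (x * y) = extD A B x * y + CliffordAlgebra.involute x * extD A B y :=
  extDFun_mul A B x y

/-- `d b = D b` (the exterior derivative extends the universal derivation). [folklore] -/
theorem extD_algebraMap (b : B) : extD A B (algebraMap B _ b) = ι B (D A B b) :=
  extDFun_algebraMap A B b

/-- `d (D b) = 0`. [folklore] -/
theorem extD_ι_D (b : B) : extD A B (ι B (D A B b)) = 0 := extDFun_ι_D A B b

/-- Leibniz rule for functions: `d (b • x) = D b ∧ x + b • d x`. [folklore] -/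
theorem extD_smul (b : B) (x : ExteriorAlgebra B (Ω[B⁄A])) :
    extD A B (b • x) = ι B (D A B b) * x + b • extD A B x := by
  rw [Algebra.smul_def, extD_mul, extD_algebraMap, AlgHom.commutes, ← Algebra.smul_def]

/-- `d (b • ω) = D b ∧ ω + b • d ω` for a one-form `ω`; with `ω = D c`: `d (b dc) = db ∧ dc`.
[folklore] -/
theorem extD_ι_smul (b : B) (ω : Ω[B⁄A]) :
    extD A B (ι B (b • ω)) = ι B (D A B b) * ι B ω + b • extD A B (ι B ω) := by
  rw [LinearMap.map_smul, Algebra.smul_def, extD_mul, extD_algebraMap, AlgHom.commutes,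
    ← Algebra.smul_def]

/-- `d (b dc) = db ∧ dc`. [folklore] -/
theorem extD_ι_smul_D (b c : B) :
    extD A B (ι B (b • D A B c)) = ι B (D A B b) * ι B (D A B c) := by
  rw [extD_ι_smul, extD_ι_D, smul_zero, add_zero]

/-- The exterior derivative of a one-form is even: `(d ω)‾ = d ω` for `ω ∈ Ω[B⁄A]`. [folklore] -/
theorem involute_extD_ι (ω : Ω[B⁄A]) :
    CliffordAlgebra.involute (extD A B (ι B ω)) = extD A B (ι B ω) := by
  obtain ⟨w, hw, h⟩ := exists_phi_eq_op A B ω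
  have : extD A B (ι B ω) = w := by simp [extDFun, h]
  rw [this, hw]

/-- `d` anticommutes with the grading involution: `d x̄ = -(d x)‾`. [folklore] -/
theorem extD_involute (x : ExteriorAlgebra B (Ω[B⁄A])) :
    extD A B (CliffordAlgebra.involute x) = -CliffordAlgebra.involute (extD A B x) := by
  induction x using ExteriorAlgebra.induction with
  | algebraMap b => rw [AlgHom.commutes, extD_algebraMap, CliffordAlgebra.involute_ι, neg_neg]
  | ι ω => rw [CliffordAlgebra.involute_ι, map_neg, involute_extD_ι]
  | mul x y hx hy =>
    rw [map_mul, extD_mul, extD_mul, hx, hy, CliffordAlgebra.involute_involute, map_add, map_mul,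
      map_mul, CliffordAlgebra.involute_involute, neg_mul, mul_neg, neg_add]
  | add x y hx hy => rw [map_add, map_add, hx, hy, map_add, map_add, neg_add]

/-- **`d ∘ d = 0`**: the exterior derivative is a differential. [folklore] -/
theorem extD_extD (x : ExteriorAlgebra B (Ω[B⁄A])) : extD A B (extD A B x) = 0 := by
  induction x using ExteriorAlgebra.induction with
  | algebraMap b => rw [extD_algebraMap, extD_ι_D]
  | ι ω =>
    have hω : ω ∈ Submodule.span B (Set.range (D A B)) := by
      rw [KaehlerDifferential.span_range_derivation]; trivial
    induction hω using Submodule.span_induction with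
    | mem x hx => obtain ⟨t, rfl⟩ := hx; rw [extD_ι_D, map_zero]
    | zero => rw [map_zero, map_zero, map_zero]
    | add x y _ _ hx hy => rw [map_add, map_add, map_add, hx, hy, add_zero]
    | smul b x _ hx =>
      rw [extD_ι_smul, map_add, extD_mul, extD_ι_D, zero_mul, zero_add, CliffordAlgebra.involute_ι,
        Algebra.smul_def, extD_mul, extD_algebraMap, hx, AlgHom.commutes, mul_zero, add_zero,
        neg_mul, neg_add_cancel]
  | mul x y hx hy =>
    rw [extD_mul, map_add, extD_mul, extD_mul, hx, hy, zero_mul, zero_add, mul_zero, add_zero,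
      extD_involute, neg_mul, add_neg_cancel]
  | add x y hx hy => rw [map_add, map_add, hx, hy, add_zero]

/-- The exterior derivative as a square-zero `A`-linear endomorphism: `d ∘ₗ d = 0`. [folklore] -/
theorem extD_comp_extD : extD A B ∘ₗ extD A B = 0 :=
  LinearMap.ext (extD_extD A B)

end KaehlerExteriorDerivative

end Literature.AlgebraicGeometry.Crystalline

end
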